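import Summits.Ventures.WeilGRH.DualTrigKernelLatticeWindow
import HarnessLib

/-!
# Format D-K v3 (multi-lattice) on a general window, part 2: the family theorem at `t = tn/td`

Cell `rh-explicit`, WEIL TRACK — GRH ARM, route B (weil-grh-3, gen18).  Continuation of
`DualTrigKernelLatticeWindow.lean` (the window lattice check `latsOKw` and `P3_nonneg_of_partsW`):

* `DKCert3.sound_familyL_of_partsW` — the multiplier inequality `0 ≤ M_{χ,N}(τ) + T(τ)` for the key group
  at every modulus `q ≥ c.base.q` from the window parts (the body of `sound_familyL`);
* `DKCert3.allAtomsT_window` — every atom has frequency `≥ 2·tn/td` (base atoms by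
  `DKCert.atomT_freq_ge_of_windowOK`, lattice atoms by `latsOKw`);
* `DKCert3.weilPositivityOnChar_window_family_of_partsW` — `WeilPositivityOnChar χ (tn/td)` for the key
  group at every modulus `q ≥ c.base.q`, given `e^{2tn/td} ≤ N + 1` (`weilPositivityOnChar_of_trigDual_window`).

Everything here is PROVED; no named facts, no `sorry`, no kernel evaluation.
-/

noncomputable section

open Finset Real Complex

namespace Summit.Ventures.WeilGRH

open Literature.Analysis.ValidatedNumerics.NumericsMP
open Literature.NumberTheory.LFunctions
open DualTrigTaylor DigammaVertical

namespace DKCert3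

variable {c : DKCert3}

/-! ### The multiplier inequality (window parts) -/

/-- **The multiplier inequality for the whole key group, every modulus `q ≥ c.base.q`, from the window frame parts
and the cell bounds.** [folklore] -/
theorem sound_familyL_of_partsWCB (hconsts : c.base.constsOK = true) (hvals : c.base.valsOK = true)
    (hnodup : c.base.valsNodup = true) (hblocks : c.base.blocksOK = true) {tn td : ℕ}
    (hlats : c.latsOKw tn td = true) (hcover : c.latCoverOK = true) (htail : c.tailOK3 = true)
    (hcb : CellBounds c) {q : ℕ} (hq : c.base.q ≤ q) (χ : DirichletCharacter ℂ q)
    (hpar : charParity χ = c.base.par) (hχ : ∀ val ∈ c.base.vals, χ (val.n : ZMod q) = DKCert.valZ val)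
    (hχ0 : ∀ n : ℕ, n ≤ c.base.N → IsPrimePow n → ¬ Nat.Coprime n c.base.q → χ (n : ZMod q) = 0) (τ : ℝ) :
    0 ≤ weilFinitePrimeWeightChar χ c.base.N τ + trigSum c.allAtomsT τ := by
  have hmain := P3_nonneg_of_partsW hconsts hvals hblocks hlats hcover htail hcb (c.base.omegaR * τ)
  obtain ⟨hS, hp0, hD, _, _, _, _, hlog, _, _⟩ := DKCert.constsOK_sound hconsts
  obtain ⟨_, hρω⟩ := DKCert.rhoR_pos_and_mul hp0 hD
  obtain ⟨_, _, hlat⟩ := latsOKw_sound hlats hS hlog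
  unfold P3 terms3R at hmain
  have hval := DKCert.sumVal_valsR_eq_family (χ := χ) hp0 hD hvals (by
    unfold DKCert.valsNodup at hnodup; simpa using hnodup) hχ hχ0 τ
  unfold DKCert.termsR at hmain
  rw [DKCert.sumVal_append, DKCert.sumVal_append, DKCert.sumVal_atoms, hval,
    sumVal_latJoinR_eq_trigSum hp0 hD τ c.lats (fun l hl ↦ ⟨(hlat l hl).1, (hlat l hl).2.2.1⟩)] at hmain
  unfold weilFinitePrimeWeightChar allAtomsT
  have harg : (c.base.sigR : ℂ) + ((c.base.rhoR * (c.base.omegaR * τ) : ℝ) : ℂ) * I =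
      1 / 4 + (charParity χ : ℂ) / 2 + (τ : ℂ) / 2 * I := by
    rw [← mul_assoc, hρω, hpar]
    unfold DKCert.sigR
    push_cast; ring
  rw [harg] at hmain
  unfold DKCert.constR at hmain
  have hlogq := DKCert.log_threshold_le (c := c.base) hq
  have hts : trigSum (List.map c.base.atomT c.base.atoms ++ c.latJoinT c.lats) τ =
      trigSum (List.map c.base.atomT c.base.atoms) τ + trigSum (c.latJoinT c.lats) τ := by
    simp [trigSum, List.map_append, List.sum_append]
  rw [hts]
  linarith


/-- **The multiplier inequality for the whole key group, every modulus `q ≥ c.base.q`, from the window parts**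
(cells through `cellsOKL`). [folklore] -/
theorem sound_familyL_of_partsW (hconsts : c.base.constsOK = true) (hvals : c.base.valsOK = true)
    (hnodup : c.base.valsNodup = true) (hblocks : c.base.blocksOK = true) {tn td : ℕ}
    (hlats : c.latsOKw tn td = true) (hcover : c.latCoverOK = true) (htail : c.tailOK3 = true)
    (hcells : c.cellsOKL = true) {q : ℕ} (hq : c.base.q ≤ q) (χ : DirichletCharacter ℂ q)
    (hpar : charParity χ = c.base.par) (hχ : ∀ val ∈ c.base.vals, χ (val.n : ZMod q) = DKCert.valZ val)
    (hχ0 : ∀ n : ℕ, n ≤ c.base.N → IsPrimePow n → ¬ Nat.Coprime n c.base.q → χ (n : ZMod q) = 0) (τ : ℝ) :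
    0 ≤ weilFinitePrimeWeightChar χ c.base.N τ + trigSum c.allAtomsT τ := by
  obtain ⟨hS, _, _, _, _, _, _, hlog, _, _⟩ := DKCert.constsOK_sound hconsts
  obtain ⟨_, _, hlat⟩ := latsOKw_sound hlats hS hlog
  exact sound_familyL_of_partsWCB hconsts hvals hnodup hblocks hlats hcover htail
    (cellBounds_of_partsL hconsts hvals hblocks (fun l hl ↦ (hlat l hl).2.2.2.2.1)
      (fun l hl ↦ (hlat l hl).2.2.2.2.2.2.2) hcells) hq χ hpar hχ hχ0 τ

/-! ### Atom admissibility for the window -/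

/-- **Window admissibility of all atoms.**  Base atoms: `2·tn·D·S ≤ k·lo(log p₀)·td`
(`DKCert.atomT_freq_ge_of_windowOK`); lattice atoms: from `latsOKw`.  Every atom of `allAtomsT` has
frequency `≥ 2 (tn / td)`. [folklore] -/
theorem allAtomsT_window (hconsts : c.base.constsOK = true) {tn td : ℕ} (htd : 0 < td)
    (hwin : (c.base.atoms.all fun atm =>
      decide ((2 * tn * c.base.D * c.base.S : ℤ) ≤ (atm.k : ℤ) * c.base.logp0C.1 * td)) = true)
    (hlats : c.latsOKw tn td = true) :
    ∀ A ∈ c.allAtomsT, 2 * ((tn : ℝ) / td) ≤ A.x := by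
  obtain ⟨hS, _, _, _, _, _, _, hlog, _, _⟩ := DKCert.constsOK_sound hconsts
  obtain ⟨_, _, hlat⟩ := latsOKw_sound hlats hS hlog
  have htdr : (0 : ℝ) < td := by exact_mod_cast htd
  intro A hA
  unfold allAtomsT at hA
  rw [List.mem_append] at hA
  rcases hA with hA | hA
  · exact DKCert.atomT_freq_ge_of_windowOK hconsts htd hwin A hA
  · have : ∀ (ls : List DKLat), (∀ l ∈ ls, l ∈ c.lats) → A ∈ c.latJoinT ls → 2 * ((tn : ℝ) / td) ≤ A.x := by
      intro ls
      induction ls with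
      | nil => intro _ h; simp [latJoinT] at h
      | cons l ls ih =>
          intro hmem h
          simp only [latJoinT, List.mem_append, List.mem_map] at h
          rcases h with ⟨atm, hatm, rfl⟩ | h
          · obtain ⟨_, _, hDl, _, _, hadm, _⟩ := hlat l (hmem l (by simp))
            have h := hadm atm hatm
            simp only [latAtomT, omegaL]
            have hDr : (0 : ℝ) < l.D := by exact_mod_cast hDl
            rw [show (2 : ℝ) * ((tn : ℝ) / td) = 2 * tn / td by ring, div_le_iff₀ htdr,
              show (atm.k : ℝ) * (Real.log l.p / l.D) * td = atm.k * Real.log l.p * td / l.D by ring,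
              le_div_iff₀ hDr]
            linarith
          · exact ih (fun l' hl' ↦ hmem l' (by simp [hl'])) h
    exact this c.lats (fun l hl ↦ hl) hA

/-! ### The rung on a general window -/

/-- **The rung on a general window for the whole key group, every modulus `q ≥ c.base.q`.**  From the
frame parts (with the window lattice check `latsOKw tn td`), the cells `cellsOKL`, the integer window
condition on the base atoms and `e^{2 tn/td} ≤ N + 1`: for every modulus `q ≥ c.base.q`, `q ≠ 1`, and every
Dirichlet character `χ` mod `q` of parity `c.base.par` with the claimed window values and `χ(n) = 0` at the
prime powers `n ≤ N` not coprime to `c.base.q`: `WeilPositivityOnChar χ (tn / td)`. [folklore] -/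
theorem weilPositivityOnChar_window_family_of_partsW (hconsts : c.base.constsOK = true)
    (hvals : c.base.valsOK = true) (hnodup : c.base.valsNodup = true) (hblocks : c.base.blocksOK = true)
    {tn td : ℕ} (htd : 0 < td) (hlats : c.latsOKw tn td = true) (hcover : c.latCoverOK = true)
    (htail : c.tailOK3 = true) (hcells : c.cellsOKL = true)
    (hwin : (c.base.atoms.all fun atm =>
      decide ((2 * tn * c.base.D * c.base.S : ℤ) ≤ (atm.k : ℤ) * c.base.logp0C.1 * td)) = true)
    (hN : Real.exp (2 * ((tn : ℝ) / td)) ≤ (c.base.N : ℝ) + 1)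
    {q : ℕ} (hq : c.base.q ≤ q) (hq1 : q ≠ 1) (χ : DirichletCharacter ℂ q) (hpar : charParity χ = c.base.par)
    (hχ : ∀ val ∈ c.base.vals, χ (val.n : ZMod q) = DKCert.valZ val)
    (hχ0 : ∀ n : ℕ, n ≤ c.base.N → IsPrimePow n → ¬ Nat.Coprime n c.base.q → χ (n : ZMod q) = 0) :
    WeilPositivityOnChar χ ((tn : ℝ) / td) :=
  weilPositivityOnChar_of_trigDual_window hq1 χ c.base.N hN c.allAtomsT
    (allAtomsT_window hconsts htd hwin hlats)
    (sound_familyL_of_partsW hconsts hvals hnodup hblocks hlats hcover htail hcells hq χ hpar hχ hχ0)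

end DKCert3

end Summit.Ventures.WeilGRH

end
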